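import Summits.ValiantsHypothesis.ValiantsHypothesis.Theorems.SymPencilPerFourInnerRankSlotAShapes
import Summits.ValiantsHypothesis.ValiantsHypothesis.Theorems.SymPencilPerFourInnerRankSlotPattern
import Summits.ValiantsHypothesis.ValiantsHypothesis.Theorems.SymPencilPerFourInnerRankSlotTypesGen

/-!
# Route `SymPencil` — inner rank of the `2 | 2` row split of `per_4`: the six shapes of the
# `a`-slot kernel at a point, as polynomial identities at that point
# (`--supports` stmt-ValiantsHypothesis-5674 `SdcSuperquadratic`; (8,8) column, isotropic-kernel route,
# bridge step (B3) of memo `NOTE-p6g15-5674-IR12-reduction.md` §8)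

**Theorem** (`shapes_at`).  For a joint family `Σ_r c_r t_r((a,b),(y₂,y₃))² = per (a; b; y₂; y₃)`
with `|ι| ≤ 11` squares and non-zero weights, and `a` with non-zero coordinates, one of:
(fst) all `2 × 2` minors of the `y₂`-block of the `a`-part vanish at `a`; (snd) the same for the
`y₃`-block; (I) for some pairwise distinct `k,l,p,q`: `t_r((a,0),(a_k e_k + a_l e_l, 0)) = 0` and
`t_r((a,0),(0, a_k e_k - a_l e_l)) = 0` for all `r`; (I') the same with the two slots exchanged;
(II) for some pairwise distinct `d,p,q,k`: `t_r((a,0),(a_p e_p - a_q e_q,0)) = 0`,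
`t_r((a,0),(a_q e_q - a_k e_k,0)) = 0`, `t_r((a,0),(0, a_p e_p + a_q e_q + a_k e_k - a_d e_d)) = 0`;
(II') the same with the slots exchanged.

Assembly of `SlotKernel.slotA_dichotomies` → `SlotPattern.pattern_cases` →
`SlotAShapes.minors_of_fst/snd` | `SlotTypesGen.typeI_members/typeII_members` (the mirrored
patterns through the `y₂ ↔ y₃`-swapped design, `SlotAShapes.hJ_yswap`, `mem_ker_yswap`).  Next
(file `…SlotA`): genericity in `a` via `GenericAlt.exists_forall_vanish`, then the mixed kills.
Honest framing: a step in a conditional reduction of the cells `(8,8,10)`, `(8,8,11)`; nothing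
about the window, the crux or `VP ≠ VNP`.  No definitions, no named facts. [folklore]
-/

noncomputable section

-- single-conjunct layout: Sub = Summit, duplicated namespace component intended
set_option linter.dupNamespace false

namespace Summit.ValiantsHypothesis.ValiantsHypothesis.Theorems.SymPencilPerFourInnerRankSlotAPoint

open Matrix Finset Module
open Summit.ValiantsHypothesis.ValiantsHypothesis.Theorems.SymPencilPerFourInnerRankSlotKernel
open Summit.ValiantsHypothesis.ValiantsHypothesis.Theorems.SymPencilPerFourInnerRankSlotAShapes
open Summit.ValiantsHypothesis.ValiantsHypothesis.Theorems.SymPencilPerFourInnerRankSlotPattern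
open Summit.ValiantsHypothesis.ValiantsHypothesis.Theorems.SymPencilPerFourInnerRankSlotTypesGen

variable {K : Type*} [Field K] {ι : Type*} [Fintype ι]

omit [Fintype ι] in
/-- Membership in the `a`-slot kernel, unpacked. [folklore] -/
theorem apply_eq_zero_of_mem_ker
    (t : ι → (((Fin 4 → K) × (Fin 4 → K)) →ₗ[K] ((Fin 4 → K) × (Fin 4 → K)) →ₗ[K] K))
    (u y : (Fin 4 → K) × (Fin 4 → K)) (hy : y ∈ LinearMap.ker (LinearMap.pi fun r => t r u))
    (r : ι) : t r u y = 0 := by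
  rw [LinearMap.mem_ker] at hy
  have := congr_fun hy r
  simpa using this

/-- **The six shapes of the `a`-slot kernel at a point.**  See the module docstring. [folklore] -/
theorem shapes_at [CharZero K] [DecidableEq ι] (hι : Fintype.card ι ≤ 11)
    (c : ι → K) (hc : ∀ r, c r ≠ 0)
    (t : ι → (((Fin 4 → K) × (Fin 4 → K)) →ₗ[K] ((Fin 4 → K) × (Fin 4 → K)) →ₗ[K] K))
    (hJ : ∀ a b y₂ y₃ : Fin 4 → K,
      ∑ r, c r * (t r (a, b) (y₂, y₃)) ^ 2 = (Matrix.of ![a, b, y₂, y₃]).permanent)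
    (a : Fin 4 → K) (ha : ∀ i, a i ≠ 0) :
    (∀ (x x' : Fin 4 → K) (r r' : ι),
      t r (a, 0) (x, 0) * t r' (a, 0) (x', 0) - t r (a, 0) (x', 0) * t r' (a, 0) (x, 0) = 0) ∨
    (∀ (x x' : Fin 4 → K) (r r' : ι),
      t r (a, 0) (0, x) * t r' (a, 0) (0, x') - t r (a, 0) (0, x') * t r' (a, 0) (0, x) = 0) ∨
    (∃ k l p q : Fin 4, k ≠ l ∧ k ≠ p ∧ k ≠ q ∧ l ≠ p ∧ l ≠ q ∧ p ≠ q ∧ ∀ r,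
      t r (a, 0) (a k • Pi.single k 1 + a l • Pi.single l 1, 0) = 0 ∧
      t r (a, 0) (0, a k • Pi.single k 1 - a l • Pi.single l 1) = 0) ∨
    (∃ k l p q : Fin 4, k ≠ l ∧ k ≠ p ∧ k ≠ q ∧ l ≠ p ∧ l ≠ q ∧ p ≠ q ∧ ∀ r,
      t r (a, 0) (0, a k • Pi.single k 1 + a l • Pi.single l 1) = 0 ∧
      t r (a, 0) (a k • Pi.single k 1 - a l • Pi.single l 1, 0) = 0) ∨
    (∃ d p q k : Fin 4, d ≠ p ∧ d ≠ q ∧ d ≠ k ∧ p ≠ q ∧ p ≠ k ∧ q ≠ k ∧ ∀ r,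
      t r (a, 0) (a p • Pi.single p 1 - a q • Pi.single q 1, 0) = 0 ∧
      t r (a, 0) (a q • Pi.single q 1 - a k • Pi.single k 1, 0) = 0 ∧
      t r (a, 0) (0, a p • Pi.single p 1 + a q • Pi.single q 1 + a k • Pi.single k 1
        - a d • Pi.single d 1) = 0) ∨
    (∃ d p q k : Fin 4, d ≠ p ∧ d ≠ q ∧ d ≠ k ∧ p ≠ q ∧ p ≠ k ∧ q ≠ k ∧ ∀ r,
      t r (a, 0) (0, a p • Pi.single p 1 - a q • Pi.single q 1) = 0 ∧
      t r (a, 0) (0, a q • Pi.single q 1 - a k • Pi.single k 1) = 0 ∧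
      t r (a, 0) (a p • Pi.single p 1 + a q • Pi.single q 1 + a k • Pi.single k 1
        - a d • Pi.single d 1, 0) = 0) := by
  obtain ⟨hA, hB⟩ := slotA_dichotomies hι c hc t hJ a ha
  set W := LinearMap.ker (LinearMap.pi fun r => t r (a, 0)) with hW
  have h3 : 3 ≤ finrank K W := three_le_finrank_ker_slotA hι c hc t hJ a
  -- the swapped design, for the mirrored patterns
  set t' : ι → (((Fin 4 → K) × (Fin 4 → K)) →ₗ[K] ((Fin 4 → K) × (Fin 4 → K)) →ₗ[K] K) :=
    fun r => (t r).compl₂ (LinearEquiv.prodComm K (Fin 4 → K) (Fin 4 → K)).toLinearMap with ht'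
  have hJ' : ∀ a b y₂ y₃ : Fin 4 → K,
      ∑ r, c r * (t' r (a, b) (y₂, y₃)) ^ 2 = (Matrix.of ![a, b, y₂, y₃]).permanent :=
    hJ_yswap c t hJ
  set W' := LinearMap.ker (LinearMap.pi fun r => t' r (a, 0)) with hW'
  have h3' : 3 ≤ finrank K W' := three_le_finrank_ker_slotA hι c hc t' hJ' a
  have hmem' : ∀ y : (Fin 4 → K) × (Fin 4 → K), y ∈ W' ↔ (y.2, y.1) ∈ W := fun y =>
    mem_ker_yswap t (a, 0) y
  have ht'ap : ∀ r (y : (Fin 4 → K) × (Fin 4 → K)), t' r (a, 0) y = t r (a, 0) (y.2, y.1) :=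
    fun r y => by simp [ht', Prod.swap]
  rcases pattern_cases a ha W hA hB with hfst | hsnd | ⟨k, l, p, q, hkl, hkp, hkq, hlp, hlq, hpq,
      hPk, hPl, hQp, hQq, hQs⟩ | ⟨k, l, p, q, hkl, hkp, hkq, hlp, hlq, hpq, hQk, hQl, hPp, hPq, hPs⟩ |
      ⟨d, p, q, k, hdp, hdq, hdk, hpq, hpk, hqk, hPd, hPs, hQp, hQq, hQk⟩ |
      ⟨d, p, q, k, hdp, hdq, hdk, hpq, hpk, hqk, hQd, hQs, hPp, hPq, hPk⟩
  · exact Or.inl fun x x' r r' => minors_of_fst t a h3 hfst x x' r r'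
  · exact Or.inr (Or.inl fun x x' r r' => minors_of_snd t a h3 hsnd x x' r r')
  · obtain ⟨h1, -, h3m⟩ := typeI_members a ha W h3 k l p q hkl hkp hkq hlp hlq hpq hPk hPl hQp hQq hQs
    exact Or.inr (Or.inr (Or.inl ⟨k, l, p, q, hkl, hkp, hkq, hlp, hlq, hpq, fun r =>
      ⟨apply_eq_zero_of_mem_ker t _ _ h1 r, apply_eq_zero_of_mem_ker t _ _ h3m r⟩⟩))
  · -- mirrored type I: the swapped design has type I
    have hPk' : ∀ y ∈ W', 2 * (y.1 k / a k) = y.1 0 / a 0 + y.1 1 / a 1 + y.1 2 / a 2 + y.1 3 / a 3 :=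
      fun y hy => hQk (y.2, y.1) ((hmem' y).1 hy)
    have hPl' : ∀ y ∈ W', 2 * (y.1 l / a l) = y.1 0 / a 0 + y.1 1 / a 1 + y.1 2 / a 2 + y.1 3 / a 3 :=
      fun y hy => hQl (y.2, y.1) ((hmem' y).1 hy)
    have hQp' : ∀ y ∈ W', 2 * (y.2 p / a p) = y.2 0 / a 0 + y.2 1 / a 1 + y.2 2 / a 2 + y.2 3 / a 3 :=
      fun y hy => hPp (y.2, y.1) ((hmem' y).1 hy)
    have hQq' : ∀ y ∈ W', 2 * (y.2 q / a q) = y.2 0 / a 0 + y.2 1 / a 1 + y.2 2 / a 2 + y.2 3 / a 3 :=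
      fun y hy => hPq (y.2, y.1) ((hmem' y).1 hy)
    have hQs' : ∀ y ∈ W', y.2 0 / a 0 + y.2 1 / a 1 + y.2 2 / a 2 + y.2 3 / a 3 = 0 :=
      fun y hy => hPs (y.2, y.1) ((hmem' y).1 hy)
    obtain ⟨h1, -, h3m⟩ :=
      typeI_members a ha W' h3' k l p q hkl hkp hkq hlp hlq hpq hPk' hPl' hQp' hQq' hQs'
    refine Or.inr (Or.inr (Or.inr (Or.inl ⟨k, l, p, q, hkl, hkp, hkq, hlp, hlq, hpq, fun r =>
      ⟨?_, ?_⟩⟩)))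
    · have := apply_eq_zero_of_mem_ker t' _ _ h1 r
      rwa [ht'ap] at this
    · have := apply_eq_zero_of_mem_ker t' _ _ h3m r
      rwa [ht'ap] at this
  · obtain ⟨h1, h2, h3m⟩ :=
      typeII_members a ha W h3 d p q k hdp hdq hdk hpq hpk hqk hPd hPs hQp hQq hQk
    exact Or.inr (Or.inr (Or.inr (Or.inr (Or.inl ⟨d, p, q, k, hdp, hdq, hdk, hpq, hpk, hqk, fun r =>
      ⟨apply_eq_zero_of_mem_ker t _ _ h1 r, apply_eq_zero_of_mem_ker t _ _ h2 r,
        apply_eq_zero_of_mem_ker t _ _ h3m r⟩⟩))))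
  · -- mirrored type II
    have hPd' : ∀ y ∈ W', 2 * (y.1 d / a d) = y.1 0 / a 0 + y.1 1 / a 1 + y.1 2 / a 2 + y.1 3 / a 3 :=
      fun y hy => hQd (y.2, y.1) ((hmem' y).1 hy)
    have hPs' : ∀ y ∈ W', y.1 0 / a 0 + y.1 1 / a 1 + y.1 2 / a 2 + y.1 3 / a 3 = 0 :=
      fun y hy => hQs (y.2, y.1) ((hmem' y).1 hy)
    have hQp' : ∀ y ∈ W', 2 * (y.2 p / a p) = y.2 0 / a 0 + y.2 1 / a 1 + y.2 2 / a 2 + y.2 3 / a 3 :=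
      fun y hy => hPp (y.2, y.1) ((hmem' y).1 hy)
    have hQq' : ∀ y ∈ W', 2 * (y.2 q / a q) = y.2 0 / a 0 + y.2 1 / a 1 + y.2 2 / a 2 + y.2 3 / a 3 :=
      fun y hy => hPq (y.2, y.1) ((hmem' y).1 hy)
    have hQk' : ∀ y ∈ W', 2 * (y.2 k / a k) = y.2 0 / a 0 + y.2 1 / a 1 + y.2 2 / a 2 + y.2 3 / a 3 :=
      fun y hy => hPk (y.2, y.1) ((hmem' y).1 hy)
    obtain ⟨h1, h2, h3m⟩ :=
      typeII_members a ha W' h3' d p q k hdp hdq hdk hpq hpk hqk hPd' hPs' hQp' hQq' hQk'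
    refine Or.inr (Or.inr (Or.inr (Or.inr (Or.inr ⟨d, p, q, k, hdp, hdq, hdk, hpq, hpk, hqk, fun r =>
      ⟨?_, ?_, ?_⟩⟩))))
    · have := apply_eq_zero_of_mem_ker t' _ _ h1 r
      rwa [ht'ap] at this
    · have := apply_eq_zero_of_mem_ker t' _ _ h2 r
      rwa [ht'ap] at this
    · have := apply_eq_zero_of_mem_ker t' _ _ h3m r
      rwa [ht'ap] at this

end Summit.ValiantsHypothesis.ValiantsHypothesis.Theorems.SymPencilPerFourInnerRankSlotAPoint

end
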